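import Summits.QuantumAdvantage.QuantumAdvantage.Theorems.CubicForrelationNearExactIsExactTwelveWeight768Hyperplane
import Summits.QuantumAdvantage.QuantumAdvantage.Theorems.CubicForrelationNearExactIsExactEightSymplectic

/-!
# Crux `CubicForrelation.NearExactIsExact` (stmt-QuantumAdvantage-14043) — no cubic Boolean function on 12 bits has weight `784`
  (a Kasami–Tokura gap value, by Fourier moments)

Certificate seat `b2b-cforr-cert` (gen 15).  HONEST FRAMING: a coding-theory lemma (standard axioms) about cubic Boolean functions on 12 bits —
the brick that closes the TYPE-O branch at the top open value `943/1024` of `θ₁₂` (there a type-O side needs a cubic base set `E` with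
`4096 + 8·#E ≤ 2¹⁷(1 − Φ) = 10368`, `#E > 768`, `16 ∣ #E`, i.e. `#E = 784`).  Classical content: by Kasami–Tokura (1970) the weights of `RM(3,12)`
below `2d = 1024` are `0, 512, 768, 896, 960, …`, so `784` does not occur; that classification is not in the tree, and the value `784` is excluded
here by a self-contained moment argument.  Finite-slice bookkeeping, NOT summit progress.

`to15_weight784_none`.  Proof.  With `E = {c = 1}`, `F(z) = Σ_{E} (−1)^{x·z}`, `I(a) = #(E ∩ (E ⊕ a))`:
* half weights (`to15_halfweight784`, second weight of `RM(4,12)`): `#(E ∩ H) ∈ {0, 256, 528, 784} ∪ [384, 400]` for every affine hyperplane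
  `H`, so `F(z) ∈ {±784, ±272} ∪ [−16, 16]`;
* derivatives (`stub_quadWalshPlateau` on the quadratic `c ⊕ c(·⊕a)`, Walsh value `960 + 4I(a)` at `0`): `I(a) ∈ {16, 272, 784}`; in particular
  `I(a) ≠ 0`, so `E` meets `E ⊕ a` for every `a`, whence `E` lies in no affine hyperplane: `F(z) ≠ ±784` for `z ≠ 0`;
* Parseval `Σ_z F² = 2¹²·784`, the fourth moment `Σ_z F⁴ = 2¹² Σ_a I(a)²`, and `Σ_a I(a) = 784²`.
Then `I² ≥ 288·I − 4352` on `{16, 272, 784}` gives `Σ_z F⁴ ≥ 2¹²(288·784² − 4352·2¹²) = 652 063 277 056`, while `F⁴ ≤ 272²·F²` off `z = 0` gives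
`Σ_z F⁴ ≤ 272²·2¹²·784 + (784⁴ − 272²·784²) = 569 909 444 608` — a contradiction.

References: T. Kasami, N. Tokura, *On the weight structure of Reed–Muller codes*, IEEE Trans. IT 16 (1970) 752–759; MacWilliams–Sloane (1977)
Ch. 15 §3; R. O'Donnell (2014) §3.3.  Everything below is proved from Mathlib and the tree; axioms are the standard three.
-/

set_option linter.dupNamespace false -- D-0017: single-problem summit ⇒ `QuantumAdvantage.QuantumAdvantage` by design

noncomputable section

namespace Summit.QuantumAdvantage.QuantumAdvantage.Theorems.CubicForrelation.NearExactIsExact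

open Finset
open Literature.Computability.QuantumComplexity
open Literature.Computability.QuantumComplexity.BuzetChailloux (bxor zeroVec bxor_bxor_cancel_left bxor_zeroVec zeroVec_bxor bxor_comm
  bxor_self twist_zeroVec_right twist_bxor_right)
open Literature.Computability.QuantumComplexity.DerivativeWalsh (W twist_bxor_left)
open Literature.Computability.QuantumComplexity.Simon (twist_eq_one_or)
open Summit.QuantumAdvantage.QuantumAdvantage.Theorems.SignedCubicForrelationNotPrBPP (knf_isDegLeFun_ip)

/-! ### Half weights of a weight-784 cubic -/

/-- **Half weights of a cubic of weight `784` on 12 bits.**  If `c` is cubic with `#{c = 1} = 784` and `ℓ` is affine, then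
`#{c = 1, ℓ = 1} ∈ {0, 256, 528, 784} ∪ [384, 400]`: both `c·ℓ` and `c·(ℓ ⊕ 1)` have degree `≤ 4`, and a degree-`4` function on 12 bits with
fewer than `384` ones has `0` or `256` of them (second weight of `RM(4,12)`, `sw_second_weight_all`). [this work] -/
theorem to15_halfweight784 (c ℓ : (Fin (6 + 6) → Bool) → Bool) (hc : IsDegLeFun 3 c) (hℓ : IsDegLeFun 1 ℓ)
    (h784 : #(univ.filter fun x => c x = true) = 784) :
    #(univ.filter fun x => (c x && ℓ x) = true) = 0 ∨ #(univ.filter fun x => (c x && ℓ x) = true) = 256 ∨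
    #(univ.filter fun x => (c x && ℓ x) = true) = 528 ∨ #(univ.filter fun x => (c x && ℓ x) = true) = 784 ∨
    (384 ≤ #(univ.filter fun x => (c x && ℓ x) = true) ∧ #(univ.filter fun x => (c x && ℓ x) = true) ≤ 400) := by
  classical
  set A := univ.filter (fun x : Fin (6 + 6) → Bool => (c x && ℓ x) = true) with hAdef
  set B := univ.filter (fun x : Fin (6 + 6) → Bool => (c x && (ℓ x ^^ true)) = true) with hBdef
  have hAB : #A + #B = 784 := by
    have eA : A = (univ.filter fun x : Fin (6 + 6) → Bool => c x = true).filter (fun x => ℓ x = true) := by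
      ext x; simp only [hAdef, mem_filter, mem_univ, true_and]; cases c x <;> cases ℓ x <;> simp
    have eB : B = (univ.filter fun x : Fin (6 + 6) → Bool => c x = true).filter (fun x => ¬ ℓ x = true) := by
      ext x; simp only [hBdef, mem_filter, mem_univ, true_and]; cases c x <;> cases ℓ x <;> simp
    rw [eA, eB, card_filter_add_card_filter_not, h784]
  have hdegA : IsDegLeFun (3 + 1) (fun x => c x && ℓ x) := te_isDegLeFun_band hc hℓ
  have hdegB : IsDegLeFun (3 + 1) (fun x => c x && (ℓ x ^^ true)) := te_isDegLeFun_band hc (tb_isDegLeFun_xor_const hℓ true)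
  have hsmall : ∀ (e : (Fin (6 + 6) → Bool) → Bool), IsDegLeFun (3 + 1) e → #(univ.filter fun x => e x = true) < 384 →
      #(univ.filter fun x => e x = true) = 0 ∨ #(univ.filter fun x => e x = true) = 256 := by
    intro e he hlt
    by_cases hne : ∃ x, e x = true
    · right
      have h := sw_second_weight_all 4 (by norm_num) (6 + 6) e he hne (by norm_num; omega)
      norm_num at h
      omega
    · left
      push Not at hne
      exact card_eq_zero.2 (filter_eq_empty_iff.2 fun x _ => by simp [hne x])
  have hA := hsmall _ hdegA
  have hB := hsmall _ hdegB
  change #A < 384 → #A = 0 ∨ #A = 256 at hA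
  change #B < 384 → #B = 0 ∨ #B = 256 at hB
  show #A = 0 ∨ #A = 256 ∨ #A = 528 ∨ #A = 784 ∨ (384 ≤ #A ∧ #A ≤ 400)
  omega

/-! ### The theorem -/

/-- **No cubic Boolean function on 12 bits has exactly `784` ones.**  (`784 ∈ (768, 896)` is a gap of the Kasami–Tokura list
`1024 − 2^{10−μ}` of `RM(3,12)` weights below `1024`; proved here by Fourier moments: half weights, plateaued quadratic derivatives, Parseval and
the fourth moment.)  Finite-slice statement; NOT summit progress. [this work] -/
theorem to15_weight784_none (c : (Fin (6 + 6) → Bool) → Bool) (hc : IsDegLeFun 3 c)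
    (h784 : #(univ.filter fun x => c x = true) = 784) : False := by
  classical
  set S := univ.filter (fun x : Fin (6 + 6) → Bool => c x = true) with hSdef
  have hmemS : ∀ x, x ∈ S ↔ c x = true := fun x => by simp [hSdef]
  set F : (Fin (6 + 6) → Bool) → ℝ := fun z => ∑ x ∈ S, twist x z with hFdef
  /- (A) the values of `F`: `784 − 2k`, `k` a half weight -/
  have hFval : ∀ z, ∃ k : ℕ, (k = 0 ∨ k = 256 ∨ k = 528 ∨ k = 784 ∨ (384 ≤ k ∧ k ≤ 400)) ∧ F z = 784 - 2 * (k : ℝ) := by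
    intro z
    set ℓ : (Fin (6 + 6) → Bool) → Bool := fun x => decide (Odd #(univ.filter fun i => x i && z i)) with hℓdef
    have hℓ : IsDegLeFun 1 ℓ := knf_isDegLeFun_ip z
    have htw : ∀ x, twist x z = 1 - 2 * (if ℓ x = true then (1 : ℝ) else 0) := by
      intro x
      rw [vg_twist_eq_signOf x z]
      change signOf (ℓ x) = 1 - 2 * (if ℓ x = true then (1 : ℝ) else 0)
      unfold signOf
      cases ℓ x <;> norm_num
    have hsum : F z = 784 - 2 * (#(univ.filter fun x => (c x && ℓ x) = true) : ℝ) := by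
      simp only [F]
      rw [sum_congr rfl fun x _ => htw x, sum_sub_distrib, sum_const, h784, ← mul_sum, sum_boole]
      have e : (univ.filter fun x : Fin (6 + 6) → Bool => c x = true).filter (fun x => ℓ x = true) =
          univ.filter fun x => (c x && ℓ x) = true := by
        ext x; simp only [mem_filter, mem_univ, true_and]; cases c x <;> cases ℓ x <;> simp
      rw [e]; norm_num
    exact ⟨_, to15_halfweight784 c ℓ hc hℓ h784, hsum⟩
  have hF0 : F zeroVec = 784 := by
    simp only [F]
    rw [sum_congr rfl fun x _ => twist_zeroVec_right x, sum_const, h784]; norm_num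
  /- (C) Parseval `Σ F² = 2¹²·784` -/
  set A : (Fin (6 + 6) → Bool) → ℝ := fun x => if x ∈ S then 1 else 0 with hAdef
  have hWA : ∀ z, W A z = F z := by
    intro z
    unfold W
    have e : ∀ x, A x * twist x z = if x ∈ S then twist x z else 0 := fun x => by
      simp only [A]; split_ifs <;> simp
    rw [sum_congr rfl fun x _ => e x, ← sum_filter, filter_mem_eq_inter, univ_inter]
  have hPars : ∑ z, F z ^ 2 = 4096 * 784 := by
    have h := fp_parseval_pm A S (fun x hx => Or.inl (by simp [A, hx])) (fun x hx => by simp [A, hx])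
    rw [sum_congr rfl fun z _ => by rw [hWA z], h784] at h
    rw [h]; norm_num
  /- (B) `I(a) = #(E ∩ (E ⊕ a)) ∈ {16, 272, 784}` -/
  set I : (Fin (6 + 6) → Bool) → ℕ := fun a => #(S.filter fun x => bxor x a ∈ S) with hIdef
  have hIle : ∀ a, I a ≤ 784 := fun a => (card_filter_le _ _).trans h784.le
  have hind : ∀ x, signOf (c x) = 1 - 2 * (if x ∈ S then (1 : ℝ) else 0) := by
    intro x
    by_cases hx : x ∈ S
    · rw [if_pos hx]; have hc' := (hmemS x).1 hx; unfold signOf; rw [if_pos hc']; norm_num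
    · rw [if_neg hx]
      have hc' : ¬ c x = true := fun h => hx ((hmemS x).2 h)
      unfold signOf; rw [if_neg hc']; norm_num
  have hIval : ∀ a, I a = 16 ∨ I a = 272 ∨ I a = 784 := by
    intro a
    have hD : IsDegLeFun 2 (fun x => c x ^^ c (bxor x a)) := stub_derivDegree (6 + 6) 2 c a hc
    obtain ⟨s, hs⟩ := stub_quadWalshPlateau (6 + 6) _ hD
    -- the Walsh value at `0` of the derivative: `960 + 4 I(a)`
    have hW0 : W (fun x => signOf (c x ^^ c (bxor x a))) zeroVec = 960 + 4 * (I a : ℝ) := by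
      unfold W
      simp_rw [twist_zeroVec_right, mul_one, signOf_xor]
      rw [sum_congr rfl fun x _ => by rw [hind x, hind (bxor x a)]]
      have e1 : ∀ x : Fin (6 + 6) → Bool, (1 - 2 * (if x ∈ S then (1 : ℝ) else 0)) * (1 - 2 * (if bxor x a ∈ S then (1 : ℝ) else 0)) =
          1 - 2 * (if x ∈ S then (1 : ℝ) else 0) - 2 * (if bxor x a ∈ S then (1 : ℝ) else 0) +
            4 * (if (x ∈ S ∧ bxor x a ∈ S) then (1 : ℝ) else 0) := by
        intro x; by_cases h1 : x ∈ S <;> by_cases h2 : bxor x a ∈ S <;> norm_num [h1, h2]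
      rw [sum_congr rfl fun x _ => e1 x, sum_add_distrib, sum_sub_distrib, sum_sub_distrib, sum_const, card_univ, Fintype.card_fun,
        Fintype.card_bool, Fintype.card_fin, ← mul_sum, ← mul_sum, ← mul_sum, sum_boole, sum_boole, sum_boole]
      have c1 : #(univ.filter fun x : Fin (6 + 6) → Bool => x ∈ S) = 784 := by
        rw [show (univ.filter fun x : Fin (6 + 6) → Bool => x ∈ S) = S by ext x; simp, h784]
      have c2 : #(univ.filter fun x : Fin (6 + 6) → Bool => bxor x a ∈ S) = 784 := by
        rw [← h784]
        refine card_nbij' (fun x => bxor x a) (fun x => bxor x a) (fun x hx => ?_) (fun x hx => ?_)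
          (fun x _ => by show bxor (bxor x a) a = x; rw [iw_bxor_assoc, bxor_self, bxor_zeroVec])
          (fun x _ => by show bxor (bxor x a) a = x; rw [iw_bxor_assoc, bxor_self, bxor_zeroVec])
        · rw [mem_coe, mem_filter] at hx; exact hx.2
        · rw [mem_coe] at hx; rw [mem_coe, mem_filter, iw_bxor_assoc, bxor_self, bxor_zeroVec]; exact ⟨mem_univ _, hx⟩
      have c3 : #(univ.filter fun x : Fin (6 + 6) → Bool => x ∈ S ∧ bxor x a ∈ S) = I a := by
        simp only [I]; congr 1; ext x; simp
      rw [c1, c2, c3]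
      norm_num
    rcases hs zeroVec with h0 | hsq
    · exfalso
      rw [hW0] at h0
      have : (0 : ℝ) ≤ I a := by positivity
      linarith
    · rw [hW0] at hsq
      have h4 : (4 : ℝ) ^ s = ((2 : ℝ) ^ s) ^ 2 := by
        rw [show (4 : ℝ) = 2 ^ 2 by norm_num, ← pow_mul, mul_comm, pow_mul]
      rw [h4] at hsq
      have hpos : (0 : ℝ) ≤ 960 + 4 * (I a : ℝ) := by positivity
      have h2s : 960 + 4 * (I a : ℝ) = (2 : ℝ) ^ s := (pow_left_inj₀ hpos (by positivity) (by norm_num : (2 : ℕ) ≠ 0)).1 hsq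
      have hIle' : (I a : ℝ) ≤ 784 := by exact_mod_cast hIle a
      have hs_le : s ≤ 12 := by
        by_contra h
        push Not at h
        have : (2 : ℝ) ^ 13 ≤ 2 ^ s := pow_le_pow_right₀ (by norm_num) h
        norm_num at this; linarith
      have hs_ge : 10 ≤ s := by
        by_contra h
        push Not at h
        have : (2 : ℝ) ^ s ≤ 2 ^ 9 := pow_le_pow_right₀ (by norm_num) (by omega)
        have : (0 : ℝ) ≤ I a := by positivity
        norm_num at *; linarith
      interval_cases s
      · left
        have h' : (I a : ℝ) = 16 := by rw [show (2 : ℝ) ^ 10 = 1024 by norm_num] at h2s; linarith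
        exact_mod_cast h'
      · right; left
        have h' : (I a : ℝ) = 272 := by rw [show (2 : ℝ) ^ 11 = 2048 by norm_num] at h2s; linarith
        exact_mod_cast h'
      · right; right
        have h' : (I a : ℝ) = 784 := by rw [show (2 : ℝ) ^ 12 = 4096 by norm_num] at h2s; linarith
        exact_mod_cast h'
  /- (N) `E` lies in no affine hyperplane: `F(z) ≠ ±784` for `z ≠ 0` -/
  have htw1 : ∀ x z : Fin (6 + 6) → Bool, twist x z ≤ 1 := fun x z => by
    rcases twist_eq_one_or x z with h | h <;> linarith
  have htw1' : ∀ x z : Fin (6 + 6) → Bool, -1 ≤ twist x z := fun x z => by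
    rcases twist_eq_one_or x z with h | h <;> linarith
  have hI0_of : ∀ (z a : Fin (6 + 6) → Bool) (t : ℝ), (t = 1 ∨ t = -1) → twist a z = -1 → (∀ x ∈ S, twist x z = t) → I a = 0 := by
    intro z a t ht ha hall
    simp only [I]
    refine card_eq_zero.2 (filter_eq_empty_iff.2 fun x hx hxa => ?_)
    have h1 := hall _ hxa
    rw [twist_bxor_left, hall x hx, ha] at h1
    rcases ht with rfl | rfl <;> norm_num at h1
  have hnoH : ∀ z, z ≠ zeroVec → F z ≠ 784 ∧ F z ≠ -784 := by
    intro z hz0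
    obtain ⟨a, ha⟩ := es_exists_twist_neg hz0
    rw [twist_comm] at ha
    have hIa : I a ≠ 0 := by rcases hIval a with h | h | h <;> omega
    constructor
    · intro hF
      refine hIa (hI0_of z a 1 (Or.inl rfl) ha fun x hx => ?_)
      have hsum0 : ∑ y ∈ S, (1 - twist y z) = 0 := by
        rw [sum_sub_distrib, sum_const, nsmul_eq_mul, h784]
        change (784 : ℕ) * (1 : ℝ) - F z = 0
        rw [hF]; norm_num
      have h := (sum_eq_zero_iff_of_nonneg fun y _ => by linarith [htw1 y z]).1 hsum0 x hx
      linarith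
    · intro hF
      refine hIa (hI0_of z a (-1) (Or.inr rfl) ha fun x hx => ?_)
      have hsum0 : ∑ y ∈ S, (1 + twist y z) = 0 := by
        rw [sum_add_distrib, sum_const, nsmul_eq_mul, h784]
        change (784 : ℕ) * (1 : ℝ) + F z = 0
        rw [hF]; norm_num
      have h := (sum_eq_zero_iff_of_nonneg fun y _ => by linarith [htw1' y z]).1 hsum0 x hx
      linarith
  /- (D) the fourth moment `Σ_z F⁴ = 2¹² · #Q`, `#Q = Σ_a J(a)²`, `J = I`, `Σ_a J(a) = 784²` -/
  set P2 := S ×ˢ S with hP2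
  set J : (Fin (6 + 6) → Bool) → ℕ := fun a => #(P2.filter fun q => bxor q.1 q.2 = a) with hJdef
  have hJI : ∀ a, J a = I a := by
    intro a
    simp only [J, I]
    refine card_nbij' (fun q => q.1) (fun x => (x, bxor x a)) (fun q hq => ?_) (fun x hx => ?_) (fun q hq => ?_) (fun x _ => rfl)
    · rw [mem_coe, mem_filter, hP2, mem_product] at hq
      rw [mem_coe, mem_filter]
      refine ⟨hq.1.1, ?_⟩
      rw [← hq.2, bxor_bxor_cancel_left]; exact hq.1.2
    · rw [mem_coe, mem_filter] at hx
      rw [mem_coe, mem_filter, hP2, mem_product]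
      exact ⟨⟨hx.1, hx.2⟩, bxor_bxor_cancel_left _ _⟩
    · rw [mem_coe, mem_filter] at hq
      obtain ⟨-, h⟩ := hq
      show (q.1, bxor q.1 a) = q
      rw [← h, bxor_bxor_cancel_left]
  have hJsum : ∑ a, (J a : ℝ) = 784 * 784 := by
    have h := card_eq_sum_card_fiberwise (s := P2) (t := (univ : Finset (Fin (6 + 6) → Bool))) (f := fun q => bxor q.1 q.2)
      (fun q _ => mem_univ _)
    rw [hP2, card_product, h784] at h
    have h' : ((784 * 784 : ℕ) : ℝ) = ∑ a, (J a : ℝ) := by rw [h]; push_cast; rfl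
    rw [← h']; norm_num
  set Q := (P2 ×ˢ P2).filter (fun q => bxor q.1.1 q.1.2 = bxor q.2.1 q.2.2) with hQdef
  have hQ : (#Q : ℝ) = ∑ a, (J a : ℝ) ^ 2 := by
    have h := card_eq_sum_card_fiberwise (s := Q) (t := (univ : Finset (Fin (6 + 6) → Bool))) (f := fun q => bxor q.1.1 q.1.2)
      (fun q _ => mem_univ _)
    rw [h]; push_cast
    refine sum_congr rfl fun a _ => ?_
    have e : Q.filter (fun q => bxor q.1.1 q.1.2 = a) = (P2.filter fun q => bxor q.1 q.2 = a) ×ˢ (P2.filter fun q => bxor q.1 q.2 = a) := by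
      ext q
      simp only [hQdef, mem_filter, mem_product]
      constructor
      · rintro ⟨⟨hq, heq⟩, ha⟩; exact ⟨⟨hq.1, ha⟩, hq.2, by rw [← heq, ha]⟩
      · rintro ⟨⟨h1, ha1⟩, h2, ha2⟩; exact ⟨⟨⟨h1, h2⟩, by rw [ha1, ha2]⟩, ha1⟩
    rw [e, card_product]; push_cast; ring
  have hF2 : ∀ z, F z ^ 2 = ∑ q ∈ P2, twist (bxor q.1 q.2) z := by
    intro z
    rw [sq, hFdef, sum_mul_sum, hP2, sum_product]
    exact sum_congr rfl fun x _ => sum_congr rfl fun y _ => (twist_bxor_left x y z).symm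
  have hF4 : ∑ z, F z ^ 4 = 4096 * (#Q : ℝ) := by
    have e1 : ∀ z, F z ^ 4 = ∑ q ∈ P2 ×ˢ P2, twist (bxor (bxor q.1.1 q.1.2) (bxor q.2.1 q.2.2)) z := by
      intro z
      rw [show F z ^ 4 = F z ^ 2 * F z ^ 2 by ring, hF2 z, sum_mul_sum, Finset.sum_product (s := P2) (t := P2)]
      exact sum_congr rfl fun q _ => sum_congr rfl fun q' _ => (twist_bxor_left _ _ z).symm
    rw [sum_congr rfl fun z _ => e1 z, sum_comm]
    rw [sum_congr rfl fun q _ => Simon.sum_twist (bxor (bxor q.1.1 q.1.2) (bxor q.2.1 q.2.2))]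
    rw [← sum_filter, sum_const, nsmul_eq_mul]
    have e2 : (P2 ×ˢ P2).filter (fun q => bxor (bxor q.1.1 q.1.2) (bxor q.2.1 q.2.2) = fun _ => false) = Q := by
      rw [hQdef]
      refine filter_congr fun q _ => ?_
      constructor
      · intro h
        have := congrArg (bxor (bxor q.1.1 q.1.2)) h
        rw [bxor_bxor_cancel_left] at this
        rw [this]; exact (bxor_zeroVec _).symm
      · intro h; rw [h]; exact bxor_self _
    rw [e2, show (2 : ℝ) ^ (6 + 6) = 4096 by norm_num, mul_comm]
  /- (E) the two-sided squeeze on `Σ_z F⁴` -/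
  have hIlin : ∀ a, 288 * (I a : ℝ) - 4352 ≤ (I a : ℝ) ^ 2 := by
    intro a; rcases hIval a with h | h | h <;> simp [h] <;> norm_num
  have hIsum : ∑ a, (I a : ℝ) = 784 * 784 := by
    have e : ∀ a, (I a : ℝ) = (J a : ℝ) := fun a => by rw [hJI a]
    rw [sum_congr rfl fun a _ => e a, hJsum]
  have hQJ : (#Q : ℝ) = ∑ a, (I a : ℝ) ^ 2 := by rw [hQ]; exact sum_congr rfl fun a _ => by rw [hJI a]
  have hI2 : 288 * (784 * 784) - 4352 * 4096 ≤ ∑ a, (I a : ℝ) ^ 2 := by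
    have h := sum_le_sum fun a (_ : a ∈ (univ : Finset (Fin (6 + 6) → Bool))) => hIlin a
    rw [sum_sub_distrib, ← mul_sum, hIsum, sum_const, card_univ, Fintype.card_fun, Fintype.card_bool, Fintype.card_fin] at h
    norm_num at h ⊢
    linarith
  have hF4pt : ∀ z, F z ^ 4 ≤ 73984 * F z ^ 2 + (if z = zeroVec then (332327288832 : ℝ) else 0) := by
    intro z
    by_cases hz : z = zeroVec
    · rw [if_pos hz, hz, hF0]; norm_num
    · rw [if_neg hz, add_zero]
      obtain ⟨k, hk, hFz⟩ := hFval z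
      obtain ⟨hne1, hne2⟩ := hnoH z hz
      have hsq : F z ^ 2 ≤ 73984 := by
        rcases hk with rfl | rfl | rfl | rfl | ⟨hk1, hk2⟩
        · exfalso; apply hne1; rw [hFz]; norm_num
        · rw [hFz]; norm_num
        · rw [hFz]; norm_num
        · exfalso; apply hne2; rw [hFz]; norm_num
        · have hk1' : (384 : ℝ) ≤ k := by exact_mod_cast hk1
          have hk2' : (k : ℝ) ≤ 400 := by exact_mod_cast hk2
          rw [hFz]
          nlinarith
      calc F z ^ 4 = F z ^ 2 * F z ^ 2 := by ring
        _ ≤ 73984 * F z ^ 2 := mul_le_mul_of_nonneg_right hsq (sq_nonneg _)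
  have hF4hi : ∑ z, F z ^ 4 ≤ 73984 * (4096 * 784) + 332327288832 := by
    have h := sum_le_sum fun z (_ : z ∈ (univ : Finset (Fin (6 + 6) → Bool))) => hF4pt z
    rw [sum_add_distrib, ← mul_sum, hPars, sum_ite_eq' univ zeroVec, if_pos (mem_univ _)] at h
    exact h
  rw [hF4, hQJ] at hF4hi
  norm_num at hF4hi hI2
  linarith

end Summit.QuantumAdvantage.QuantumAdvantage.Theorems.CubicForrelation.NearExactIsExact

end
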